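import Summits.CriticalPhenomena.CardyFormulaZ2.Theorems.CardyBoundaryCoulombGasRectilinearCardyStubKernelWindowLawPart2
import Summits.CriticalPhenomena.CardyFormulaZ2.Theorems.CardyBoundaryCoulombGasBoundaryDefectGaussianRStubRigidityOfLocalLawsPart6
import Summits.CriticalPhenomena.CardyFormulaZ2.Theorems.CardyBoundaryCoulombGasBoundaryDefectGaussianRStubRealisabilityPart47
import HarnessLib

/-!
# Stub B `stub_rowBlocks` of line `excursion-kernel-covariance`, part 1: lattice frames and the
# boundary walk along a straight side
# (crux `RectilinearCardy`, stmt-CriticalPhenomena-5660, route `CardyBoundaryCoulombGas`)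

Lattice bookkeeping for the ROW BLOCKS stub, in the coordinates `ℤ × ℤ` of the Baxter–Kelland–Wu
collar (`CollarLegModel.dir / dsucc / outDart / neighbours`); a lattice point `x : ℤ × ℤ` is read as
the site `![x.1, x.2] : Site 2` of the tree (`meshPoint`, `Orient.nrm`, `Orient.tng`):

* the dictionary between the tree's four orientations `Orient` (domain above / below / right / left
  of a straight piece of boundary) and the four lattice directions `dir k` (`rb_orient_table`): an
  OUTWARD direction `k₀` (the only step lowering the normal coordinate `Orient.nrm`), the walk
  direction `dir (k₀ + 1)` (domain on the LEFT, as for `dsucc`) along which the tangential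
  coordinate moves by a sign `s`, and the inward lattice normal `dv`;
* mesh points of lattice points and lattice steps (`rb_mesh_eq`, `rb_site_add_dir`, `rb_dist_mesh_le`);
* the lattice polygon `V = {x : δ x ∈ Ω̄}` near a straight side `{nrmC o = h}` (inside a ball where
  `Ω̄ = {nrmC o ≥ h}`): membership is `⌈h/δ⌉ ≤ nrm` (`rb_memV_iff`), the row `nrm = ⌈h/δ⌉` consists of
  vertices with exactly one outside neighbour and exterior dart `(x, k₀)` (`rb_row_vertex`), every
  exterior dart there is such a row dart (`rb_ext_dart_row`), and the walk goes straight: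
  `dsucc V (x, k₀) = (x + dir (k₀ + 1), k₀)` and its iterates march along the row (`rb_dsucc_row`,
  `rb_iterate_row`).

All [folklore].
-/

noncomputable section

open Set Metric
open Literature.Probability.RandomPlanarGeometry
open Literature.Probability.LatticeModels (Site meshPoint Orient cornerUnit dist_meshPoint_add_cornerUnit)
open Literature.Probability.LatticeModels.CollarLegModel (Dart dartTip dir dsucc outDart neighbours)
open Summit.CriticalPhenomena.CardyFormulaZ2.Cruxes.BoundaryDefectGaussianR.RainbowMonomialsInExcursionKernels
  (s3_outDart_of_card tp_dir_val)

namespace Summit.CriticalPhenomena.CardyFormulaZ2.Cruxes.RectilinearCardy.ExcursionKernelCovariance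

/-! ### Mesh points of `ℤ × ℤ` -/

/-- The engine's mesh point `x₁ δ + x₂ δ i` is the tree's `meshPoint` of the site `![x₁, x₂]`. [folklore] -/
theorem rb_mesh_eq (δ : ℝ) (x : ℤ × ℤ) :
    ((x.1 : ℂ) * δ + (x.2 : ℂ) * δ * Complex.I) = meshPoint δ (![x.1, x.2] : Site 2) := by
  apply Complex.ext <;>
    simp [Literature.Probability.LatticeModels.meshPoint_re, Literature.Probability.LatticeModels.meshPoint_im,
      mul_comm]

/-- The tree's `meshPoint` of a site is the mesh point of its coordinate pair. [folklore] -/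
theorem rb_meshPoint_pair (δ : ℝ) (y : Site 2) : meshPoint δ y = meshPoint δ (![y 0, y 1] : Site 2) := by
  apply Complex.ext <;>
    simp [Literature.Probability.LatticeModels.meshPoint_re, Literature.Probability.LatticeModels.meshPoint_im]

/-- Lattice steps in the two coordinate systems: `![(x + dir k)₁, (x + dir k)₂] = ![x₁, x₂] + cornerUnit k`.
[folklore] -/
theorem rb_site_add_dir (x : ℤ × ℤ) (k : Fin 4) :
    (![(x + dir k).1, (x + dir k).2] : Site 2) = ![x.1, x.2] + cornerUnit k := by
  obtain ⟨h0, h1, h2, h3⟩ := tp_dir_val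
  fin_cases k <;> ext i <;> fin_cases i <;> simp [h0, h1, h2, h3, cornerUnit]

/-- Distance of the mesh points of lattice neighbours is `δ`. [folklore] -/
theorem rb_dist_mesh_dir {δ : ℝ} (hδ : 0 < δ) (x : ℤ × ℤ) (k : Fin 4) :
    dist (meshPoint δ (![(x + dir k).1, (x + dir k).2] : Site 2)) (meshPoint δ (![x.1, x.2] : Site 2)) = δ := by
  rw [rb_site_add_dir, dist_meshPoint_add_cornerUnit hδ]

/-- Distance of mesh points is controlled by the `ℓ¹` lattice distance. [folklore] -/
theorem rb_dist_mesh_le {δ : ℝ} (hδ : 0 ≤ δ) (x y : ℤ × ℤ) :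
    dist (meshPoint δ (![x.1, x.2] : Site 2)) (meshPoint δ (![y.1, y.2] : Site 2)) ≤
      δ * (|((x.1 - y.1 : ℤ) : ℝ)| + |((x.2 - y.2 : ℤ) : ℝ)|) := by
  rw [dist_eq_norm]
  have hre : (meshPoint δ (![x.1, x.2] : Site 2) - meshPoint δ (![y.1, y.2] : Site 2)).re =
      δ * ((x.1 - y.1 : ℤ) : ℝ) := by
    simp [Complex.sub_re, Literature.Probability.LatticeModels.meshPoint_re]; ring
  have him : (meshPoint δ (![x.1, x.2] : Site 2) - meshPoint δ (![y.1, y.2] : Site 2)).im =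
      δ * ((x.2 - y.2 : ℤ) : ℝ) := by
    simp [Complex.sub_im, Literature.Probability.LatticeModels.meshPoint_im]; ring
  calc ‖meshPoint δ (![x.1, x.2] : Site 2) - meshPoint δ (![y.1, y.2] : Site 2)‖
      ≤ |(meshPoint δ (![x.1, x.2] : Site 2) - meshPoint δ (![y.1, y.2] : Site 2)).re| +
          |(meshPoint δ (![x.1, x.2] : Site 2) - meshPoint δ (![y.1, y.2] : Site 2)).im| :=
        Complex.norm_le_abs_re_add_abs_im _
    _ = δ * (|((x.1 - y.1 : ℤ) : ℝ)| + |((x.2 - y.2 : ℤ) : ℝ)|) := by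
        rw [hre, him, abs_mul, abs_mul, abs_of_nonneg hδ]; ring

/-- Mesh points determine the lattice point (`δ ≠ 0`). [folklore] -/
theorem rb_mesh_injective {δ : ℝ} (hδ : δ ≠ 0) {x y : ℤ × ℤ}
    (h : meshPoint δ (![x.1, x.2] : Site 2) = meshPoint δ (![y.1, y.2] : Site 2)) : x = y := by
  have h1 := congrArg Complex.re h
  have h2 := congrArg Complex.im h
  simp only [Literature.Probability.LatticeModels.meshPoint_re, Literature.Probability.LatticeModels.meshPoint_im,
    Matrix.cons_val_zero, Matrix.cons_val_one] at h1 h2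
  have h1' : (x.1 : ℝ) = y.1 := mul_left_cancel₀ hδ h1
  have h2' : (x.2 : ℝ) = y.2 := mul_left_cancel₀ hδ h2
  exact Prod.ext (by exact_mod_cast h1') (by exact_mod_cast h2')

/-- Distance marched in `n` lattice steps. [folklore] -/
theorem rb_dist_mesh_nsmul_le {δ : ℝ} (hδ : 0 < δ) (x : ℤ × ℤ) (k : Fin 4) (n : ℕ) :
    dist (meshPoint δ (![(x + n • dir k).1, (x + n • dir k).2] : Site 2)) (meshPoint δ (![x.1, x.2] : Site 2)) ≤
      n * δ := by
  induction n with
  | zero => simp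
  | succ n ih =>
    rw [succ_nsmul, ← add_assoc]
    calc dist (meshPoint δ (![(x + n • dir k + dir k).1, (x + n • dir k + dir k).2] : Site 2))
          (meshPoint δ (![x.1, x.2] : Site 2))
        ≤ dist (meshPoint δ (![(x + n • dir k + dir k).1, (x + n • dir k + dir k).2] : Site 2))
            (meshPoint δ (![(x + n • dir k).1, (x + n • dir k).2] : Site 2)) +
            dist (meshPoint δ (![(x + n • dir k).1, (x + n • dir k).2] : Site 2))
              (meshPoint δ (![x.1, x.2] : Site 2)) := dist_triangle _ _ _
      _ ≤ δ + n * δ := add_le_add (rb_dist_mesh_dir hδ _ _).le ih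
      _ = (n + 1 : ℕ) * δ := by push_cast; ring

/-! ### Orientations versus lattice directions -/

/-- **The lattice frame of an orientation.** For each orientation `o` there are an OUTWARD
direction `k₀` (`up ↦ S`, `down ↦ N`, `right ↦ W`, `left ↦ E`), a step sign `s = ±1` and an inward
lattice normal `dv` such that: the normal coordinate drops by one across the side, is kept along and
against the walk direction `dir (k₀ + 1)` and rises by one into the domain; the tangential
coordinate moves by `s` along the walk and by `-s` against it; only the outward step lowers the
normal coordinate; and normal differences are scalar products with `dv`. [folklore] -/
theorem rb_orient_table (o : Orient) :
    ∃ (k₀ : Fin 4) (s : ℤ) (dv : ℤ × ℤ), (s = 1 ∨ s = -1) ∧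
      (dv = (1, 0) ∨ dv = (-1, 0) ∨ dv = (0, 1) ∨ dv = (0, -1)) ∧
      (∀ x : ℤ × ℤ,
        Orient.nrm o (![(x + dir k₀).1, (x + dir k₀).2] : Site 2) = Orient.nrm o (![x.1, x.2] : Site 2) - 1 ∧
        Orient.nrm o (![(x + dir (k₀ + 1)).1, (x + dir (k₀ + 1)).2] : Site 2) = Orient.nrm o (![x.1, x.2] : Site 2) ∧
        Orient.nrm o (![(x + dir (k₀ + 2)).1, (x + dir (k₀ + 2)).2] : Site 2) = Orient.nrm o (![x.1, x.2] : Site 2) + 1 ∧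
        Orient.nrm o (![(x + dir (k₀ + 3)).1, (x + dir (k₀ + 3)).2] : Site 2) = Orient.nrm o (![x.1, x.2] : Site 2) ∧
        Orient.tng o (![(x + dir (k₀ + 1)).1, (x + dir (k₀ + 1)).2] : Site 2) = Orient.tng o (![x.1, x.2] : Site 2) + s ∧
        Orient.tng o (![(x + dir (k₀ + 3)).1, (x + dir (k₀ + 3)).2] : Site 2) = Orient.tng o (![x.1, x.2] : Site 2) - s) ∧
      (∀ (x : ℤ × ℤ) (k : Fin 4),
        Orient.nrm o (![x.1, x.2] : Site 2) - 1 ≤ Orient.nrm o (![(x + dir k).1, (x + dir k).2] : Site 2) ∧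
        (Orient.nrm o (![(x + dir k).1, (x + dir k).2] : Site 2) = Orient.nrm o (![x.1, x.2] : Site 2) - 1 ↔ k = k₀)) ∧
      (∀ w x : ℤ × ℤ, Orient.nrm o (![w.1, w.2] : Site 2) - Orient.nrm o (![x.1, x.2] : Site 2) =
        (w.1 - x.1) * dv.1 + (w.2 - x.2) * dv.2) := by
  obtain ⟨h0, h1, h2, h3⟩ := tp_dir_val
  cases o
  · refine ⟨3, 1, (0, 1), Or.inl rfl, Or.inr (Or.inr (Or.inl rfl)), fun x => ?_, fun x k => ?_, fun w x => ?_⟩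
    · refine ⟨?_, ?_, ?_, ?_, ?_, ?_⟩ <;> simp [Orient.nrm, Orient.tng, h0, h1, h2, h3]
      all_goals ring
    · fin_cases k <;> simp [Orient.nrm, h0, h1, h2, h3] <;> omega
    · simp [Orient.nrm]
  · refine ⟨1, -1, (0, -1), Or.inr rfl, Or.inr (Or.inr (Or.inr rfl)), fun x => ?_, fun x k => ?_, fun w x => ?_⟩
    · refine ⟨?_, ?_, ?_, ?_, ?_, ?_⟩ <;> simp [Orient.nrm, Orient.tng, h0, h1, h2, h3]
      all_goals ring
    · fin_cases k <;> simp [Orient.nrm, h0, h1, h2, h3] <;> omega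
    · simp [Orient.nrm]; ring
  · refine ⟨2, -1, (1, 0), Or.inr rfl, Or.inl rfl, fun x => ?_, fun x k => ?_, fun w x => ?_⟩
    · refine ⟨?_, ?_, ?_, ?_, ?_, ?_⟩ <;> simp [Orient.nrm, Orient.tng, h0, h1, h2, h3]
      all_goals ring
    · fin_cases k <;> simp [Orient.nrm, h0, h1, h2, h3] <;> omega
    · simp [Orient.nrm]
  · refine ⟨0, 1, (-1, 0), Or.inl rfl, Or.inr (Or.inl rfl), fun x => ?_, fun x k => ?_, fun w x => ?_⟩
    · refine ⟨?_, ?_, ?_, ?_, ?_, ?_⟩ <;> simp [Orient.nrm, Orient.tng, h0, h1, h2, h3]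
      all_goals ring
    · fin_cases k <;> simp [Orient.nrm, h0, h1, h2, h3] <;> omega
    · simp [Orient.nrm]; ring

/-! ### Neighbour counts -/

/-- The four neighbours are the four lattice steps. [folklore] -/
theorem rb_mem_neighbours_iff {x y : ℤ × ℤ} : y ∈ neighbours x ↔ ∃ k : Fin 4, y = x + dir k := by
  obtain ⟨h0, h1, h2, h3⟩ := tp_dir_val
  obtain ⟨a, b⟩ := x
  simp only [neighbours, Finset.mem_insert, Finset.mem_singleton]
  constructor
  · rintro (rfl | rfl | rfl | rfl)
    · exact ⟨0, by simp [h0]⟩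
    · exact ⟨1, by simp [h1]⟩
    · exact ⟨2, by simp [h2, sub_eq_add_neg]⟩
    · exact ⟨3, by simp [h3, sub_eq_add_neg]⟩
  · rintro ⟨k, rfl⟩
    fin_cases k <;> simp [h0, h1, h2, h3, sub_eq_add_neg]

/-- **Exactly one outside direction gives neighbour count one.** [folklore] -/
theorem rb_card_eq_one_of_unique {V : Finset (ℤ × ℤ)} {x : ℤ × ℤ} {k₀ : Fin 4} (hk₀ : x + dir k₀ ∉ V)
    (huniq : ∀ k : Fin 4, x + dir k ∉ V → k = k₀) : ((neighbours x).filter (fun y ↦ y ∉ V)).card = 1 := by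
  rw [Finset.card_eq_one]
  refine ⟨x + dir k₀, Finset.ext fun y => ?_⟩
  rw [Finset.mem_filter, Finset.mem_singleton, rb_mem_neighbours_iff]
  constructor
  · rintro ⟨⟨k, rfl⟩, hy⟩
    rw [huniq k hy]
  · rintro rfl
    exact ⟨⟨k₀, rfl⟩, hk₀⟩

/-- The three cases of the boundary successor `dsucc V (v, k)` (convex turn / straight / reflex
turn), as rewriting rules. [folklore] -/
-- adapted from `s3_dsucc_cases` (…BoundaryDefectGaussianRStubRigidityOfLocalLawsPart4)
theorem rb_dsucc_cases (V : Finset (ℤ × ℤ)) (v : ℤ × ℤ) (k : Fin 4) :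
    (v + dir (k + 1) ∉ V → dsucc V (v, k) = (v, k + 1)) ∧
    (v + dir (k + 1) ∈ V → v + dir (k + 1) + dir k ∉ V → dsucc V (v, k) = (v + dir (k + 1), k)) ∧
    (v + dir (k + 1) ∈ V → v + dir (k + 1) + dir k ∈ V →
      dsucc V (v, k) = (v + dir (k + 1) + dir k, k + 3)) := by
  refine ⟨fun hA ↦ ?_, fun hA hB ↦ ?_, fun hA hB ↦ ?_⟩
  · simp [dsucc, hA]
  · simp [dsucc, hA, hB]
  · simp [dsucc, hA, hB]

/-! ### The lattice polygon along a straight side -/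

section Side

variable {Ω : Set ℂ} {V : Finset (ℤ × ℤ)} {δ : ℝ} {o : Orient} {h r : ℝ} {c : ℂ} {k₀ : Fin 4}

/-- **Membership near the side is the normal coordinate test** `⌈h/δ⌉ ≤ nrm`. [folklore] -/
theorem rb_memV_iff (hV : ∀ x : ℤ × ℤ, x ∈ V ↔ meshPoint δ (![x.1, x.2] : Site 2) ∈ closure Ω) (hδ : 0 < δ)
    (hcl : ∀ z, dist z c < r → (z ∈ closure Ω ↔ h ≤ Orient.nrmC o z)) {x : ℤ × ℤ}
    (hx : dist (meshPoint δ (![x.1, x.2] : Site 2)) c < r) :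
    x ∈ V ↔ ⌈h / δ⌉ ≤ Orient.nrm o (![x.1, x.2] : Site 2) := by
  rw [hV x, hcl _ hx, Orient.nrmC_meshPoint, Int.ceil_le, div_le_iff₀ hδ, mul_comm]

/-- **Row vertices.** A vertex on the row `nrm = ⌈h/δ⌉`, `δ`-inside the ball, lies in `V`, its
outward neighbour does not and is its only outside neighbour; so it has neighbour count one and
exterior dart `(x, k₀)`. [folklore] -/
theorem rb_row_vertex (hV : ∀ x : ℤ × ℤ, x ∈ V ↔ meshPoint δ (![x.1, x.2] : Site 2) ∈ closure Ω) (hδ : 0 < δ)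
    (hcl : ∀ z, dist z c < r → (z ∈ closure Ω ↔ h ≤ Orient.nrmC o z))
    (hk₀ : ∀ (x : ℤ × ℤ) (k : Fin 4),
      Orient.nrm o (![x.1, x.2] : Site 2) - 1 ≤ Orient.nrm o (![(x + dir k).1, (x + dir k).2] : Site 2) ∧
      (Orient.nrm o (![(x + dir k).1, (x + dir k).2] : Site 2) = Orient.nrm o (![x.1, x.2] : Site 2) - 1 ↔ k = k₀))
    {x : ℤ × ℤ} (hx : dist (meshPoint δ (![x.1, x.2] : Site 2)) c + δ < r)
    (hrow : Orient.nrm o (![x.1, x.2] : Site 2) = ⌈h / δ⌉) :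
    x ∈ V ∧ x + dir k₀ ∉ V ∧ (∀ k : Fin 4, x + dir k ∉ V → k = k₀) ∧
      ((neighbours x).filter (fun y ↦ y ∉ V)).card = 1 ∧ outDart V x = some (x, k₀) := by
  have hd0 : 0 ≤ dist (meshPoint δ (![x.1, x.2] : Site 2)) c := dist_nonneg
  have hxV : x ∈ V := (rb_memV_iff hV hδ hcl (by linarith)).2 hrow.ge
  have hnb : ∀ k : Fin 4, dist (meshPoint δ (![(x + dir k).1, (x + dir k).2] : Site 2)) c < r := fun k => by
    have h1 := dist_triangle (meshPoint δ (![(x + dir k).1, (x + dir k).2] : Site 2))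
      (meshPoint δ (![x.1, x.2] : Site 2)) c
    have h2 := rb_dist_mesh_dir hδ x k
    linarith
  have hout : x + dir k₀ ∉ V := by
    rw [rb_memV_iff hV hδ hcl (hnb _), ((hk₀ x k₀).2).2 rfl, hrow]
    omega
  have huniq : ∀ k : Fin 4, x + dir k ∉ V → k = k₀ := by
    intro k hk
    rw [rb_memV_iff hV hδ hcl (hnb k), not_le] at hk
    have h1 := (hk₀ x k).1
    exact (hk₀ x k).2.1 (by omega)
  refine ⟨hxV, hout, huniq, rb_card_eq_one_of_unique hout huniq, ?_⟩
  obtain ⟨k, hk, -, hk'⟩ := s3_outDart_of_card V x (rb_card_eq_one_of_unique hout huniq)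
  rw [hk, ← hk' k₀ hout]

/-- **Exterior darts near the side are row darts**: if `x ∈ V`, `x + dir k ∉ V` and `x` is
`δ`-inside the ball, then `nrm = ⌈h/δ⌉` at `x` and `k = k₀`. [folklore] -/
theorem rb_ext_dart_row (hV : ∀ x : ℤ × ℤ, x ∈ V ↔ meshPoint δ (![x.1, x.2] : Site 2) ∈ closure Ω) (hδ : 0 < δ)
    (hcl : ∀ z, dist z c < r → (z ∈ closure Ω ↔ h ≤ Orient.nrmC o z))
    (hk₀ : ∀ (x : ℤ × ℤ) (k : Fin 4),
      Orient.nrm o (![x.1, x.2] : Site 2) - 1 ≤ Orient.nrm o (![(x + dir k).1, (x + dir k).2] : Site 2) ∧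
      (Orient.nrm o (![(x + dir k).1, (x + dir k).2] : Site 2) = Orient.nrm o (![x.1, x.2] : Site 2) - 1 ↔ k = k₀))
    {x : ℤ × ℤ} {k : Fin 4} (hx : dist (meshPoint δ (![x.1, x.2] : Site 2)) c + δ < r) (hxV : x ∈ V)
    (hk : x + dir k ∉ V) : Orient.nrm o (![x.1, x.2] : Site 2) = ⌈h / δ⌉ ∧ k = k₀ := by
  have hd0 : 0 ≤ dist (meshPoint δ (![x.1, x.2] : Site 2)) c := dist_nonneg
  have hnb : dist (meshPoint δ (![(x + dir k).1, (x + dir k).2] : Site 2)) c < r := by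
    have h1 := dist_triangle (meshPoint δ (![(x + dir k).1, (x + dir k).2] : Site 2))
      (meshPoint δ (![x.1, x.2] : Site 2)) c
    have h2 := rb_dist_mesh_dir hδ x k
    linarith
  rw [rb_memV_iff hV hδ hcl (by linarith)] at hxV
  rw [rb_memV_iff hV hδ hcl hnb, not_le] at hk
  obtain ⟨h1, h2⟩ := hk₀ x k
  have hrow : Orient.nrm o (![x.1, x.2] : Site 2) = ⌈h / δ⌉ := by omega
  exact ⟨hrow, h2.1 (by omega)⟩

/-- **The walk goes straight along the side**: `dsucc V (x, k₀) = (x + dir (k₀ + 1), k₀)` for a row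
vertex `2δ`-inside the ball. [folklore] -/
theorem rb_dsucc_row (hV : ∀ x : ℤ × ℤ, x ∈ V ↔ meshPoint δ (![x.1, x.2] : Site 2) ∈ closure Ω) (hδ : 0 < δ)
    (hcl : ∀ z, dist z c < r → (z ∈ closure Ω ↔ h ≤ Orient.nrmC o z))
    (hk₀ : ∀ (x : ℤ × ℤ) (k : Fin 4),
      Orient.nrm o (![x.1, x.2] : Site 2) - 1 ≤ Orient.nrm o (![(x + dir k).1, (x + dir k).2] : Site 2) ∧
      (Orient.nrm o (![(x + dir k).1, (x + dir k).2] : Site 2) = Orient.nrm o (![x.1, x.2] : Site 2) - 1 ↔ k = k₀))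
    (hk₁ : ∀ x : ℤ × ℤ,
      Orient.nrm o (![(x + dir (k₀ + 1)).1, (x + dir (k₀ + 1)).2] : Site 2) = Orient.nrm o (![x.1, x.2] : Site 2))
    {x : ℤ × ℤ} (hx : dist (meshPoint δ (![x.1, x.2] : Site 2)) c + 2 * δ < r)
    (hrow : Orient.nrm o (![x.1, x.2] : Site 2) = ⌈h / δ⌉) :
    dsucc V (x, k₀) = (x + dir (k₀ + 1), k₀) := by
  have hx' : dist (meshPoint δ (![(x + dir (k₀ + 1)).1, (x + dir (k₀ + 1)).2] : Site 2)) c + δ < r := by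
    have h1 := dist_triangle (meshPoint δ (![(x + dir (k₀ + 1)).1, (x + dir (k₀ + 1)).2] : Site 2))
      (meshPoint δ (![x.1, x.2] : Site 2)) c
    have h2 := rb_dist_mesh_dir hδ x (k₀ + 1)
    linarith
  obtain ⟨hin, hout, -⟩ := rb_row_vertex hV hδ hcl hk₀ hx' ((hk₁ x).trans hrow)
  exact (rb_dsucc_cases V x k₀).2.1 hin hout

/-- **Marching along the side**: the iterates of the walk from a row dart are the row darts
`(x + j • dir (k₀ + 1), k₀)`, as long as the march stays `2δ`-inside the ball. [folklore] -/
theorem rb_iterate_row (hV : ∀ x : ℤ × ℤ, x ∈ V ↔ meshPoint δ (![x.1, x.2] : Site 2) ∈ closure Ω) (hδ : 0 < δ)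
    (hcl : ∀ z, dist z c < r → (z ∈ closure Ω ↔ h ≤ Orient.nrmC o z))
    (hk₀ : ∀ (x : ℤ × ℤ) (k : Fin 4),
      Orient.nrm o (![x.1, x.2] : Site 2) - 1 ≤ Orient.nrm o (![(x + dir k).1, (x + dir k).2] : Site 2) ∧
      (Orient.nrm o (![(x + dir k).1, (x + dir k).2] : Site 2) = Orient.nrm o (![x.1, x.2] : Site 2) - 1 ↔ k = k₀))
    (hk₁ : ∀ x : ℤ × ℤ,
      Orient.nrm o (![(x + dir (k₀ + 1)).1, (x + dir (k₀ + 1)).2] : Site 2) = Orient.nrm o (![x.1, x.2] : Site 2))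
    {x : ℤ × ℤ} (hrow : Orient.nrm o (![x.1, x.2] : Site 2) = ⌈h / δ⌉) {n : ℕ}
    (hx : dist (meshPoint δ (![x.1, x.2] : Site 2)) c + (n + 2) * δ < r) :
    ∀ j ≤ n, (dsucc V)^[j] (x, k₀) = (x + j • dir (k₀ + 1), k₀) ∧
      Orient.nrm o (![(x + j • dir (k₀ + 1)).1, (x + j • dir (k₀ + 1)).2] : Site 2) = ⌈h / δ⌉ := by
  intro j hj
  induction j with
  | zero => simpa using hrow
  | succ j ih =>
    obtain ⟨ih1, ih2⟩ := ih (Nat.le_of_succ_le hj)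
    have hrow' : Orient.nrm o (![(x + (j + 1) • dir (k₀ + 1)).1, (x + (j + 1) • dir (k₀ + 1)).2] : Site 2) =
        ⌈h / δ⌉ := by
      rw [succ_nsmul, ← add_assoc, hk₁, ih2]
    refine ⟨?_, hrow'⟩
    rw [Function.iterate_succ_apply', ih1, succ_nsmul, ← add_assoc]
    refine rb_dsucc_row hV hδ hcl hk₀ hk₁ ?_ ih2
    have h1 := rb_dist_mesh_nsmul_le hδ x (k₀ + 1) j
    have h2 : (j : ℝ) + 1 ≤ n := by exact_mod_cast hj
    have h3 := dist_triangle (meshPoint δ (![(x + j • dir (k₀ + 1)).1, (x + j • dir (k₀ + 1)).2] : Site 2))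
      (meshPoint δ (![x.1, x.2] : Site 2)) c
    nlinarith [hδ.le]

end Side

end Summit.CriticalPhenomena.CardyFormulaZ2.Cruxes.RectilinearCardy.ExcursionKernelCovariance

end
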